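import Summits.Ventures.LatticeQCDFlow.Exactness.AcceptanceFromMeanEnergyViolationSharp
import Summits.Ventures.LatticeQCDFlow.Exactness.Phi4MetropolisSiteInvolution
import HarnessLib

/-!
HONEST FRAMING: exact (Metropolis-corrected) sampling algorithms for lattice gauge theory; figures
of merit are autocorrelation/cost numbers at stated couplings and volumes; no continuum-physics
claim.

# Phi4MetropolisSiteSharpFloor — THE EXTREMAL FLOOR FOR THE SINGLE-SITE METROPOLIS UPDATE AND FOR THE SCAN:
# `⟨a_x⟩ ≥ 1 − (cosh a − 1 + ⟨ΔS_x⟩)/(a + sinh a)` FOR EVERY `a > 0`, AND — BECAUSE THE PENCIL IS AFFINE IN THE MEAN —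
# THE SAME FLOOR FOR THE SCAN AT THE SCAN-AVERAGED MEAN, WITH NO CAUCHY–SCHWARZ LOSS (row 22 `su3-ptbc`, GEN-10, ours;
# sequel of row 2's `Phi4MetropolisSiteInvolution` / `Phi4MetropolisSitePinskerFloor`)

Venture `LatticeQCDFlow` (cell pub-lqcd), topic `Exactness`; FANOUT row 22 (`su3-ptbc`; §0 is what the PTBC swap
records use — a measured pair acceptance certifies a floor on `⟨ΔS⟩`; §1 serves row 2's local Metropolis arm).  NEW
WORK of the cell: row 2's dictionary `Phi4MetropolisSiteInvolution` (the random-walk site update `Ψ_x(u, φ) = (−u, φ + u e_x)` is a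
Lebesgue-preserving involution with `e^{−H} = e^{−S(φ)}ρ(u)`, `ΔH = ΔS_x = S(φ + u e_x) − S(φ)`) composed with
this seat's `involutive_acceptance_ge_cosh`.  Nothing is cited as a fact; no definition; no numerics.

THE POINT.  Row 2's Pinsker floor for the site update, `1 − ⟨a_x⟩ ≤ √(⟨ΔS_x⟩/2)`, becomes the sharp pencil
`1 − ⟨a_x⟩ ≤ (cosh a − 1 + ⟨ΔS_x⟩)/(a + sinh a)` (`a > 0`; envelope `tanh(a⋆/2)` at `a⋆tanh(a⋆/2) = ⟨ΔS_x⟩`).  A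
structural bonus: the pencil is AFFINE in the mean, so summing the site floors over a scan gives the same floor
at the scan-averaged mean `m̄ = |s|⁻¹Σ_x⟨ΔS_x⟩` EXACTLY — `Σ_x ⟨a_x⟩·Z ≥ (|s| − (|s|(cosh a − 1) + Σ_x⟨ΔS_x⟩)/(a + sinh a))·Z`
— whereas the concave Pinsker floor needed Cauchy–Schwarz (`metropolisScan_acceptance_ge_pinsker`) and loses when
the site means are unequal.  (The envelope over `a` of the summed pencil is the two-state curve at `m̄`.)

## What is proved (`S` measurable with `e^{−S}` integrable; `ρ > 0` even measurable, `∫ ρ = 1`; first moments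
`ΔS_x ρ e^{−S} ∈ L¹` as hypotheses)

* §0 (general framework) **`involutive_meanViolation_ge_of_acceptance_le`** — acceptance `≤ α·Z` (`0 < α < 1`) ⇒
  `(1 − α)·log((2 − α)/α)·Z ≤ ∫ ΔH e^{−H}`: a measured acceptance of ANY reversible volume-preserving update certifies
  a floor on its mean energy violation (the pencil member `tanh(a/2) = 1 − α`).
* **`metropolisSite_acceptance_ge_cosh`** — every site `x`, every `a > 0`:
  `(1 − (cosh a − 1 + ⟨ΔS_x⟩)/(a + sinh a))·Z ≤ ∫∫ min(1, e^{−ΔS_x}) ρ(u) e^{−S(φ)} du dφ`;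
* **`phi4MetropolisSite_acceptance_ge_cosh`** — lattice φ⁴, `λ > 0`, real `J`;
* **`metropolisScan_acceptance_ge_cosh`** — any finite set of sites `s`, every `a > 0`:
  `(|s| − (|s|(cosh a − 1) + Σ_{x∈s}⟨ΔS_x⟩)/(a + sinh a))·Z ≤ Σ_{x∈s} ∫∫ min(1, e^{−ΔS_x}) ρ e^{−S}`.

NOT CLAIMED: as in the parents (window densities; values for any run).
-/

namespace Summit.Ventures.LatticeQCDFlow.Exactness

open Real MeasureTheory Filter
open Summit.Ventures.LatticeQCDFlow.Scoring

/-! ## §0 The converse reading in the general framework: acceptance `≤ α` certifies `⟨ΔH⟩ ≥ (1−α)·log((2−α)/α)` -/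

section Converse

variable {X : Type*} [MeasurableSpace X] {μ : Measure X}

/-- **A LOW ACCEPTANCE CERTIFIES A LARGE MEAN ENERGY VIOLATION** (every volume-preserving reversible proposal —
HMC streams, swaps, flips): under the hypotheses of `involutive_acceptance_ge_cosh`, if
`∫ min(1, e^{−ΔH}) e^{−H} ≤ α·Z` with `0 < α < 1` then `(1 − α)·log((2 − α)/α)·Z ≤ ∫ ΔH e^{−H}` — the pencil member
with `tanh(a/2) = 1 − α`; e.g. `α = 1/2 ⇒ ⟨ΔH⟩ ≥ ½·log 3`, `α = 1/5 ⇒ ⟨ΔH⟩ ≥ (4/5)·log 9`. [ours] -/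
theorem involutive_meanViolation_ge_of_acceptance_le {H : X → ℝ} {Ψ : X → X} (hH : Measurable H)
    (hΨm : Measurable Ψ) (hΨi : Function.Involutive Ψ) (hΨμ : MeasurePreserving Ψ μ μ)
    (hw : Integrable (fun z => Real.exp (-H z)) μ)
    (hΔ : Integrable (fun z => deltaH H Ψ z * Real.exp (-H z)) μ) (hZ : 0 < ∫ z, Real.exp (-H z) ∂μ)
    {α : ℝ} (hα0 : 0 < α) (hα1 : α < 1)
    (hacc : ∫ z, min 1 (Real.exp (-deltaH H Ψ z)) * Real.exp (-H z) ∂μ ≤ α * ∫ z, Real.exp (-H z) ∂μ) :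
    (1 - α) * Real.log ((2 - α) / α) * ∫ z, Real.exp (-H z) ∂μ ≤ ∫ z, deltaH H Ψ z * Real.exp (-H z) ∂μ := by
  set Z := ∫ z, Real.exp (-H z) ∂μ with hZdef
  set M := ∫ z, deltaH H Ψ z * Real.exp (-H z) ∂μ with hMdef
  set a := Real.log ((2 - α) / α) with ha_def
  have hu : 0 < (2 - α) / α := div_pos (by linarith) hα0
  have hu1 : 1 < (2 - α) / α := by rw [lt_div_iff₀ hα0]; linarith
  have ha : 0 < a := Real.log_pos hu1
  have hc : 0 < a + Real.sinh a := add_pos ha (Real.sinh_pos_iff.mpr ha)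
  have h := involutive_acceptance_ge_cosh hH hΨm hΨi hΨμ hw hΔ hZ ha
  have h1 : (1 - (Real.cosh a - 1 + M / Z) / (a + Real.sinh a)) * Z ≤ α * Z := h.trans hacc
  have h2 : 1 - (Real.cosh a - 1 + M / Z) / (a + Real.sinh a) ≤ α := le_of_mul_le_mul_right h1 hZ
  have h3 : 1 - α ≤ (Real.cosh a - 1 + M / Z) / (a + Real.sinh a) := by linarith
  rw [le_div_iff₀ hc] at h3
  have hid : Real.cosh a - 1 = (1 - α) * Real.sinh a := by
    rw [Real.cosh_eq, Real.sinh_eq, Real.exp_neg, ha_def, Real.exp_log hu]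
    have hα : α ≠ 0 := hα0.ne'
    have h2' : (2 - α) ≠ 0 := by intro h; linarith
    field_simp
    ring
  -- `(1 − α)·a ≤ M/Z`
  have h4 : (1 - α) * a ≤ M / Z := by nlinarith [h3, hid]
  rw [le_div_iff₀ hZ] at h4
  exact h4

end Converse

section Site

variable {n : ℕ}

/-- **THE EXTREMAL FLOOR FOR THE SITE-METROPOLIS ACCEPTANCE, GENERAL ACTION**: for every `a > 0`,
`(1 − (cosh a − 1 + ⟨ΔS_x⟩)/(a + sinh a))·Z ≤ ∫∫ min(1, e^{−ΔS_x}) ρ e^{−S}`. [ours] -/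
theorem metropolisSite_acceptance_ge_cosh {S : (Fin (n + 1) → ℝ) → ℝ} (hSm : Measurable S)
    (hSi : Integrable (fun φ => Real.exp (-S φ))) {ρ : ℝ → ℝ} (hρ0 : ∀ u, 0 < ρ u)
    (hρm : Measurable ρ) (hρs : ∀ u, ρ (-u) = ρ u) (hρ1 : ∫ u, ρ u = 1) (x : Fin (n + 1))
    (hΔ : Integrable (fun p : ℝ × (Fin (n + 1) → ℝ) =>
      (S (p.2 + Pi.single x p.1) - S p.2) * (Real.exp (-S p.2) * ρ p.1))
      ((volume : Measure ℝ).prod (volume : Measure (Fin (n + 1) → ℝ)))) {a : ℝ} (ha : 0 < a) :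
    (1 - (Real.cosh a - 1 + (∫ p, (S (p.2 + Pi.single x p.1) - S p.2)
        * (Real.exp (-S p.2) * ρ p.1) ∂((volume : Measure ℝ).prod (volume : Measure (Fin (n + 1) → ℝ))))
        / ∫ φ, Real.exp (-S φ)) / (a + Real.sinh a))
      * ∫ φ, Real.exp (-S φ)
      ≤ ∫ p, min 1 (Real.exp (-(S (p.2 + Pi.single x p.1) - S p.2))) * (Real.exp (-S p.2) * ρ p.1)
          ∂((volume : Measure ℝ).prod (volume : Measure (Fin (n + 1) → ℝ))) := by
  set μ2 : Measure (ℝ × (Fin (n + 1) → ℝ)) :=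
    (volume : Measure ℝ).prod (volume : Measure (Fin (n + 1) → ℝ)) with hμ2
  set H : ℝ × (Fin (n + 1) → ℝ) → ℝ := fun q => S q.2 - Real.log (ρ q.1) with hH
  set Ψ : ℝ × (Fin (n + 1) → ℝ) → ℝ × (Fin (n + 1) → ℝ) := fun q => (-q.1, q.2 + Pi.single x q.1) with hΨ
  have hHm : Measurable H := (hSm.comp measurable_snd).sub ((Real.measurable_log.comp hρm).comp measurable_fst)
  have hexpH : ∀ q, Real.exp (-H q) = Real.exp (-S q.2) * ρ q.1 := fun q => exp_neg_H_site S hρ0 q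
  have hρi : Integrable ρ := by
    by_contra h
    rw [integral_undef h] at hρ1
    exact zero_ne_one hρ1
  have hw : Integrable (fun q => Real.exp (-H q)) μ2 := by
    simp_rw [hexpH]
    have h := (hρi.mul_prod hSi : Integrable (fun q : ℝ × (Fin (n + 1) → ℝ) => ρ q.1 * Real.exp (-S q.2)) μ2)
    exact h.congr (Eventually.of_forall fun q => by ring)
  have hZeq : ∫ q, Real.exp (-H q) ∂μ2 = ∫ φ, Real.exp (-S φ) := by
    simp_rw [hexpH]
    have h := integral_prod_mul (μ := (volume : Measure ℝ)) (ν := (volume : Measure (Fin (n + 1) → ℝ)))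
      ρ (fun φ => Real.exp (-S φ))
    rw [show (fun q : ℝ × (Fin (n + 1) → ℝ) => Real.exp (-S q.2) * ρ q.1)
        = fun q => ρ q.1 * Real.exp (-S q.2) from funext fun q => mul_comm _ _, h, hρ1, one_mul]
  have hZ : 0 < ∫ q, Real.exp (-H q) ∂μ2 := by rw [hZeq]; exact integral_exp_pos hSi
  have hΔH : ∀ q, deltaH H Ψ q = S (q.2 + Pi.single x q.1) - S q.2 := fun q => deltaH_site_eq S hρs x q
  have hΔ' : Integrable (fun q => deltaH H Ψ q * Real.exp (-H q)) μ2 :=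
    hΔ.congr (Eventually.of_forall fun q => by simp only [hΔH, hexpH])
  have key := involutive_acceptance_ge_cosh hHm (measurable_siteShear x) (siteShear_involutive x)
    (measurePreserving_siteShear x) hw hΔ' hZ ha
  have e1 : ∫ q, deltaH H Ψ q * Real.exp (-H q) ∂μ2
      = ∫ q, (S (q.2 + Pi.single x q.1) - S q.2) * (Real.exp (-S q.2) * ρ q.1) ∂μ2 :=
    integral_congr_ae (Eventually.of_forall fun q => by simp only [hΔH, hexpH])
  have e2 : ∫ q, min 1 (Real.exp (-deltaH H Ψ q)) * Real.exp (-H q) ∂μ2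
      = ∫ q, min 1 (Real.exp (-(S (q.2 + Pi.single x q.1) - S q.2))) * (Real.exp (-S q.2) * ρ q.1) ∂μ2 :=
    integral_congr_ae (Eventually.of_forall fun q => by simp only [hΔH, hexpH])
  rw [e1, e2, hZeq] at key
  exact key

/-- **THE EXTREMAL FLOOR FOR THE SITE-METROPOLIS ACCEPTANCE OF LATTICE φ⁴** (`λ > 0`, real `J`, every site, every
positive even step density, every `a > 0`). [ours] -/
theorem phi4MetropolisSite_acceptance_ge_cosh {lam : ℝ} (hlam : 0 < lam)
    (J : Fin (n + 1) → Fin (n + 1) → ℝ) {ρ : ℝ → ℝ} (hρ0 : ∀ u, 0 < ρ u) (hρm : Measurable ρ)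
    (hρs : ∀ u, ρ (-u) = ρ u) (hρ1 : ∫ u, ρ u = 1) (x : Fin (n + 1))
    (hΔ : Integrable (fun p : ℝ × (Fin (n + 1) → ℝ) =>
      (latticePhi4Action J lam (p.2 + Pi.single x p.1) - latticePhi4Action J lam p.2)
        * (gibbsWeight J lam p.2 * ρ p.1))
      ((volume : Measure ℝ).prod (volume : Measure (Fin (n + 1) → ℝ)))) {a : ℝ} (ha : 0 < a) :
    (1 - (Real.cosh a - 1 + (∫ p, (latticePhi4Action J lam (p.2 + Pi.single x p.1)
        - latticePhi4Action J lam p.2) * (gibbsWeight J lam p.2 * ρ p.1)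
          ∂((volume : Measure ℝ).prod (volume : Measure (Fin (n + 1) → ℝ)))) / gibbsZ J lam)
        / (a + Real.sinh a)) * gibbsZ J lam
      ≤ ∫ p, min 1 (Real.exp (-(latticePhi4Action J lam (p.2 + Pi.single x p.1)
          - latticePhi4Action J lam p.2))) * (gibbsWeight J lam p.2 * ρ p.1)
          ∂((volume : Measure ℝ).prod (volume : Measure (Fin (n + 1) → ℝ))) :=
  metropolisSite_acceptance_ge_cosh (continuous_latticePhi4Action J lam).measurable
    (integrable_gibbsWeight hlam J) hρ0 hρm hρs hρ1 x hΔ ha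

/-- **THE EXTREMAL FLOOR FOR THE SCAN, WITHOUT CAUCHY–SCHWARZ**: summed over any finite set of sites `s`, for
every `a > 0`: `(|s| − (|s|(cosh a − 1) + Σ_{x∈s} ⟨ΔS_x⟩)/(a + sinh a))·Z ≤ Σ_{x∈s} ∫∫ min(1, e^{−ΔS_x}) ρ e^{−S}` —
the pencil is affine in the mean, so the scan obeys the site floor at the scan-averaged mean exactly. [ours] -/
theorem metropolisScan_acceptance_ge_cosh {S : (Fin (n + 1) → ℝ) → ℝ} (hSm : Measurable S)
    (hSi : Integrable (fun φ => Real.exp (-S φ))) {ρ : ℝ → ℝ} (hρ0 : ∀ u, 0 < ρ u)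
    (hρm : Measurable ρ) (hρs : ∀ u, ρ (-u) = ρ u) (hρ1 : ∫ u, ρ u = 1) (s : Finset (Fin (n + 1)))
    (hΔ : ∀ x ∈ s, Integrable (fun p : ℝ × (Fin (n + 1) → ℝ) =>
      (S (p.2 + Pi.single x p.1) - S p.2) * (Real.exp (-S p.2) * ρ p.1))
      ((volume : Measure ℝ).prod (volume : Measure (Fin (n + 1) → ℝ)))) {a : ℝ} (ha : 0 < a) :
    ((s.card : ℝ) - ((s.card : ℝ) * (Real.cosh a - 1) + ∑ x ∈ s,
        (∫ p, (S (p.2 + Pi.single x p.1) - S p.2) * (Real.exp (-S p.2) * ρ p.1)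
          ∂((volume : Measure ℝ).prod (volume : Measure (Fin (n + 1) → ℝ)))) / ∫ φ, Real.exp (-S φ))
        / (a + Real.sinh a))
      * ∫ φ, Real.exp (-S φ)
      ≤ ∑ x ∈ s, ∫ p, min 1 (Real.exp (-(S (p.2 + Pi.single x p.1) - S p.2)))
          * (Real.exp (-S p.2) * ρ p.1) ∂((volume : Measure ℝ).prod (volume : Measure (Fin (n + 1) → ℝ))) := by
  set Z : ℝ := ∫ φ, Real.exp (-S φ) with hZdef
  set m : Fin (n + 1) → ℝ := fun x => (∫ p, (S (p.2 + Pi.single x p.1) - S p.2)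
      * (Real.exp (-S p.2) * ρ p.1) ∂((volume : Measure ℝ).prod (volume : Measure (Fin (n + 1) → ℝ)))) / Z
    with hmdef
  have hsite : ∀ x ∈ s, (1 - (Real.cosh a - 1 + m x) / (a + Real.sinh a)) * Z
      ≤ ∫ p, min 1 (Real.exp (-(S (p.2 + Pi.single x p.1) - S p.2))) * (Real.exp (-S p.2) * ρ p.1)
          ∂((volume : Measure ℝ).prod (volume : Measure (Fin (n + 1) → ℝ))) :=
    fun x hx => metropolisSite_acceptance_ge_cosh hSm hSi hρ0 hρm hρs hρ1 x (hΔ x hx) ha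
  have hsum := Finset.sum_le_sum hsite
  rw [← Finset.sum_mul] at hsum
  have e1 : ∑ x ∈ s, (1 - (Real.cosh a - 1 + m x) / (a + Real.sinh a))
      = (s.card : ℝ) - ((s.card : ℝ) * (Real.cosh a - 1) + ∑ x ∈ s, m x) / (a + Real.sinh a) := by
    rw [Finset.sum_sub_distrib, Finset.sum_const, nsmul_eq_mul, mul_one, ← Finset.sum_div,
      Finset.sum_add_distrib, Finset.sum_const, nsmul_eq_mul]
  rw [e1] at hsum
  exact hsum

end Site

end Summit.Ventures.LatticeQCDFlow.Exactness
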